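import Mathlib
import Summits.Ventures.HodgeRepro2.T6N5FockHyp

/-!
# T6N5FockMain — the conjugate-orthogonal Fock dictionary and condition (b) at the real places FROM THE
DISPLAYS BY NAME (Tier 6, README §10.3; sub-step N5 of the M2 discharge, t6-p7)

`fockDictCO_of_displays` = `N5Fock.fockDictCO_of_carrier` with its two interface binders replaced by the
displays `Hyp.KonnoKonno2007_Thm5_4_i_lines` / `Hyp.KonnoKonno2007_Fact5_1_compact` (T6N5FockHyp), and
`Verdict.realCondB_of_displays` = condition (b) at the three real places of the VERDICT data, both sides,
from the displayed Epsilon Dichotomy (t6-p8's `Hyp.BFGYYZ2025_Thm3_5` on the real-place instances), the two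
Konno–Konno displays on a K-type carrier per place and side, and the EX identifications (the datum's theta
predicates read off the carriers, the calibration εψ·sW = −1) — the VERDICT half-lines are in kernel
(p410050).  Residual classes on a v7: PO 3 (Thm 3.5 ×6 instances; Thm 5.4(i) — print pending W-11;
Fact 5.1), EX (the identifications), IR 0.  Joint non-vacuity: `Toy.toyReal_joint'` on the carrier and
datum of `T6N5FockCarrier.Toy`.  Count-neutral.
§8(d): uses an L-value-free non-vanishing device: NO.
-/

namespace Summit.Ventures.HodgeRepro2.T6.N5Fock

open Summit.Ventures.HodgeRepro2.T6.N5LocalDatum Summit.Ventures.HodgeRepro2.T6.N5Rich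
  Summit.Ventures.HodgeRepro2.T6.Hyp Summit.Ventures.HodgeRepro2.T6.N5RealPlace

/-- THE CONJUGATE-ORTHOGONAL FOCK DICTIONARY FROM THE DISPLAYS BY NAME: `fockDictCO_of_carrier` with the
interface binders replaced by `Hyp.KonnoKonno2007_Thm5_4_i_lines` and `Hyp.KonnoKonno2007_Fact5_1_compact`. -/
theorem fockDictCO_of_displays (R : RealData) (C : KTypeCarrier) (sW εψ : ℤˣ)
    (hcal : εψ * sW = -1) (hodd : Odd R.mA')
    (hT : ∀ s w, R.Theta s w ↔ thetaOf C sW εψ R.mA' s w)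
    (h54 : KonnoKonno2007_Thm5_4_i_lines C) (h51 : KonnoKonno2007_Fact5_1_compact C) :
    R.FockDictCO :=
  fockDictCO_of_carrier R C sW εψ hcal hodd hT h54 h51

/-- The VERDICT's m′_A(j) is odd at every real place (m′₁ − 2 = 2n₁ − 1; m′_j + 2ε_j = 2n_j + 1 + 2ε_j). -/
theorem Verdict.mA'_odd (V : Verdict) (j : Fin 3) : Odd (V.mA' j) := by
  unfold Verdict.mA'
  rw [Int.odd_iff]
  rcases Int.units_eq_one_or (V.ε j) with h | h <;> split_ifs <;>
    (try simp only [h, Units.val_one, Units.val_neg]) <;> omega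

/-- CONDITION (b) AT THE THREE REAL PLACES FOR THE VERDICT DATA, BOTH SIDES, FROM THE DISPLAYS: the Epsilon
Dichotomy on every real-place instance, a K-type carrier `CA j` / `CB j` per place and side with the two
Konno–Konno displays, the EX identifications (`hTA` / `hTB`: the datum's theta predicates are read off the
carriers; `hcalA` / `hcalB`: the calibration); the oddness of the VERDICT's m′_A(j) is the kernel's
(`Verdict.mA'_odd`). -/
theorem Verdict.realCondB_of_displays (V : Verdict) (kind : Fin 3 → PlaceKind)
    (D : Fin 3 → LocalSignDatum) (ξ : ∀ v, Fin 4 → (D v).Char)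
    (h35A : ∀ j, BFGYYZ2025_Thm3_5 (V.realA j).toLocal)
    (h35B : ∀ j, BFGYYZ2025_Thm3_5 (V.realB j).toLocal)
    (CA CB : Fin 3 → KTypeCarrier) (sWA sWB εψA εψB : Fin 3 → ℤˣ)
    (hcalA : ∀ j, εψA j * sWA j = -1) (hcalB : ∀ j, εψB j * sWB j = -1)
    (hTA : ∀ j s w, (V.realA j).Theta s w ↔ thetaOf (CA j) (sWA j) (εψA j) (V.mA' j) s w)
    (hTB : ∀ j s w, (V.realB j).Theta s w ↔ thetaOf (CB j) (sWB j) (εψB j) (V.mA' j) s w)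
    (h54A : ∀ j, KonnoKonno2007_Thm5_4_i_lines (CA j))
    (h54B : ∀ j, KonnoKonno2007_Thm5_4_i_lines (CB j))
    (h51A : ∀ j, KonnoKonno2007_Fact5_1_compact (CA j))
    (h51B : ∀ j, KonnoKonno2007_Fact5_1_compact (CB j)) :
    (SignModel.ofReal kind D ξ V.realA V.realB).RealCondB :=
  V.realCondB_CO kind D ξ h35A h35B
    (fun j => fockDictCO_of_displays (V.realA j) (CA j) (sWA j) (εψA j) (hcalA j) (Verdict.mA'_odd V j)
      (hTA j) (h54A j) (h51A j))
    (fun j => fockDictCO_of_displays (V.realB j) (CB j) (sWB j) (εψB j) (hcalB j) (Verdict.mA'_odd V j)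
      (hTB j) (h54B j) (h51B j))

namespace Toy

/-- The two displays hold on the half-line carrier (definitionally). -/
theorem carrier_displays : KonnoKonno2007_Thm5_4_i_lines carrier ∧ KonnoKonno2007_Fact5_1_compact carrier :=
  ⟨carrier_kTypeHalfLine, carrier_howeCompact⟩

/-- JOINT NON-VACUITY through the displays: the toy datum's `FockDictCO` from `fockDictCO_of_displays`, with
the Epsilon Dichotomy, the half-lines and the sign equation (b). -/
theorem toyReal_joint' : KonnoKonno2007_Thm5_4_i_lines carrier ∧ KonnoKonno2007_Fact5_1_compact carrier ∧
    BFGYYZ2025_Thm3_5 toyReal.toLocal ∧ toyReal.FockDictCO ∧ (∀ i, toyReal.HalfLine i) ∧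
    ∀ i, toyReal.eps (toyReal.ξ i) = toyReal.sign i :=
  have hF : toyReal.FockDictCO :=
    fockDictCO_of_displays toyReal carrier (-1) 1 (by decide) ⟨0, by decide⟩ toyReal_theta
      carrier_kTypeHalfLine carrier_howeCompact
  ⟨carrier_kTypeHalfLine, carrier_howeCompact, toyReal_thm3_5, hF, toyReal_halfLine,
    fun i => toyReal.condB_line_CO toyReal_thm3_5 hF i (toyReal_halfLine i)⟩

end Toy

end Summit.Ventures.HodgeRepro2.T6.N5Fock
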